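import Literature.NumberTheory.Sieve.SmoothParityMinorArcsSaddle
import Literature.NumberTheory.Sieve.SmoothParityAsymptoticLemmas
import Literature.NumberTheory.Sieve.SmoothSaddleScaleCompare
import HarnessLib

/-!
# Parity-class friable ternary counts: the minor arcs in flat form

Topic `Literature/NumberTheory/Sieve`, namespace `Literature.NumberTheory.Sieve.SmoothArcs`; a PROVED bookkeeping sequel
of `SmoothParityMinorArcsSaddle` ([Harper2016, Theorems 1, 2 and §5]).  `parity_minor_arcs_of_minor_saddle` bounds the
minor-arc part of the circle method for `d₁n₁ + σd₂n₂ = n₃` by Hölder–restriction data at the three scales `X_i = x/e_i`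
(`𝓟(X_i)`, the saddle sizes at the LOCAL saddle points `α(X_i, y)`, and the supremum `S₃` of the free factor at the
ambient scale `2X₃`).  Here everything is converted to the MASTER saddle point `α = α(x, y)` and the main-term units
`Mv_i = e_i^{−α}𝓜`, `𝓜 = x^αζ(α,y)/√(2πφ₂(α,y))`:

`parity_minor_arcs_flat`: for `e_i ≤ e_B ≤ √x` in the regime, `N₀ ≤ 2x`, `1 ≤ R_b ≤ R ≤ (2X₃)^{1/10}`, `‖c₃‖_W ≤ P`,
  `0 < G₀ ≤ 𝓜`, `φ₂(α, y) ≤ Φ`: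
  `‖Σ_{r ∈ T} V₁V₂V̄₃‖ ≤ Mv₁Mv₂Mv₃ · C (log x)^{24} e_B s^{1/2}` with the scalar
  `s = P(C (log 2x)³ y^{1/4000} R_b^{−9/20} · 2√5·√(2πΦ) + (164(1 + log 2x)² y² (2x)^{9/10} + 1) e_B/G₀ + 64√(2πΦ)/R_b²)`
  `    + 8√(2πΦ)P/R_b³`
  (`𝓟(X_i) ≤ C_sc e_i^{−α}𝓟(x)` by `scale_compare`, `(1+N₀/X_i) ≤ 3e_B`, Rankin at the master saddle point for
  `Ψ(X₃, y)` and for `(2X₃)^{α'}ζ(α')`, `1 − 10⁻⁴ ≤ α' = α(2X₃, y) ≤ 1 + 4/log y ≤ 2` for `y ≥ e^{107}`).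

Every term of `s` is `o((log x)^{−48} e_B^{−2})` along the polylog regime with `R_b` a large power of `log x`; that limit is
taken in `SmoothParityAsymptotic`.

## References

* A. J. Harper, Compositio Math. 152 (2016), Theorems 1, 2 and §5 [Harper2016].
-/

noncomputable section

open Finset Real Complex
open scoped FourierTransform

namespace Literature.NumberTheory.Sieve

namespace SmoothArcs

open TwistedWeight

/-! ### The minor arcs, flat form -/

set_option maxHeartbeats 3200000 in
/-- **THE MINOR ARCS of the parity-class friable ternary count, flat form.**  In the regime of
`parity_minor_arcs_of_minor_saddle` at the scales `X_i = x/e_i` (`1 ≤ e_i ≤ e_B ≤ √x`), with `x` in the range of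
`scale_compare`, `1 − 10⁻⁴ ≤ α(2X₃, y)`, `y ≥ e^{107}`, `N₀ ≤ 2x`, `1 ≤ R_b ≤ R ≤ (2X₃)^{1/10}`, `‖c₃‖_W ≤ P`, `0 < G₀ ≤ 𝓜`, `φ₂(α,y) ≤ Φ`:
`‖Σ_{r ∈ T} V₁(d₁r/N₀)V₂(σd₂r/N₀)V̄₃(r/N₀)‖ ≤ Mv₁Mv₂Mv₃ · C (log x)^{24} e_B s^{1/2}` for every `T ⊆ [0, N₀)` of points minor
at `(R, R/X₃)`, with the scalar `s` of the module docstring. [cite: Harper2016, Theorems 1, 2 and §5] -/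
theorem parity_minor_arcs_flat :
    ∃ C x₀ : ℝ, 0 < C ∧ ∀ (x : ℝ) (y : ℕ) (e₁ e₂ e₃ : ℕ) (eB : ℝ),
      x₀ ≤ x → Real.log x ^ 4 ≤ (y : ℝ) → Real.log (y : ℝ) ≤ Real.log x ^ (1 / 5 : ℝ) → saddlePoint x y ≤ 1 →
      1 ≤ e₁ → 1 ≤ e₂ → 1 ≤ e₃ → (e₁ : ℝ) ≤ eB → (e₂ : ℝ) ≤ eB → (e₃ : ℝ) ≤ eB → eB ≤ x ^ (1 / 2 : ℝ) →
      x₀ ≤ x / e₁ → Real.log (x / e₁) ^ 8 ≤ (y : ℝ) → Real.log (y : ℝ) ≤ 1 / 2 * Real.log (x / e₁) ^ (1 / 6 : ℝ) →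
      (y : ℝ) ^ 200 ≤ x / e₁ → 1 - 1 / 10000 ≤ saddlePoint (x / e₁) y →
      (x / e₁) ^ ((39999 : ℝ) / 40000) ≤ ((Nat.smoothNumbersUpTo ⌊x / e₁⌋₊ (y + 1)).card : ℝ) →
      x₀ ≤ x / e₂ → Real.log (x / e₂) ^ 8 ≤ (y : ℝ) → Real.log (y : ℝ) ≤ 1 / 2 * Real.log (x / e₂) ^ (1 / 6 : ℝ) →
      (y : ℝ) ^ 200 ≤ x / e₂ → 1 - 1 / 10000 ≤ saddlePoint (x / e₂) y →
      (x / e₂) ^ ((39999 : ℝ) / 40000) ≤ ((Nat.smoothNumbersUpTo ⌊x / e₂⌋₊ (y + 1)).card : ℝ) →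
      x₀ ≤ x / e₃ → Real.log (x / e₃) ^ 8 ≤ (y : ℝ) → Real.log (y : ℝ) ≤ 1 / 2 * Real.log (x / e₃) ^ (1 / 6 : ℝ) →
      (y : ℝ) ^ 200 ≤ x / e₃ → 1 - 1 / 10000 ≤ saddlePoint (x / e₃) y →
      (x / e₃) ^ ((39999 : ℝ) / 40000) ≤ ((Nat.smoothNumbersUpTo ⌊x / e₃⌋₊ (y + 1)).card : ℝ) →
      Real.log (2 * (x / e₃)) ^ 8 ≤ (y : ℝ) → 1 - 1 / 10000 ≤ saddlePoint (2 * (x / e₃)) y → ⌈Real.exp 107⌉₊ ≤ y →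
      ∀ (N₀ : ℕ), 1 ≤ N₀ → (N₀ : ℝ) ≤ 2 * x → ∀ (σ : ℤ), (σ = 1 ∨ σ = -1) → ∀ (d₁ d₂ : ℕ), IsCoprime (d₁ : ℤ) N₀ →
      IsCoprime (d₂ : ℤ) N₀ → ∀ (R Rb : ℝ), 1 ≤ Rb → Rb ≤ R → R ≤ (2 * (x / e₃)) ^ (1 / 10 : ℝ) →
      ∀ (c₁ c₂ c₃ : ℤ → ℂ), (∀ v : ℝ, ‖profileFn c₁ v‖ ≤ 1) → (∀ v : ℝ, ‖profileFn c₂ v‖ ≤ 1) →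
      (∀ v : ℝ, ‖profileFn c₃ v‖ ≤ 1) → Summable (fun ℓ : ℤ => ‖c₃ ℓ‖ * (1 + |(ℓ : ℝ)|) ^ 3) →
      ∀ (P : ℝ), profileNorm c₃ ≤ P →
      ∀ (G₀ : ℝ), 0 < G₀ → G₀ ≤ x ^ saddlePoint x y * smoothZeta (saddlePoint x y) y /
        Real.sqrt (2 * Real.pi * saddlePhi₂ (saddlePoint x y) y) →
      ∀ (Φ : ℝ), saddlePhi₂ (saddlePoint x y) y ≤ Φ →
      ∀ (T : Finset ℕ), T ⊆ Finset.range N₀ →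
      (∀ r ∈ T, ∀ q : ℕ, 1 ≤ q → (q : ℝ) ≤ R → ∀ a : ℤ, R / (x / e₃) < |(r : ℝ) / N₀ - a / q|) →
        ‖∑ r ∈ T, classProfileSum (x / e₁) y 2 1 c₁ ((d₁ : ℝ) * r / N₀) *
            classProfileSum (x / e₂) y 2 1 c₂ ((σ : ℝ) * d₂ * r / N₀) *
            starRingEnd ℂ (classProfileSum (x / e₃) y 1 0 c₃ ((r : ℝ) / N₀))‖ ≤
          ((e₁ : ℝ) ^ (-saddlePoint x y) * (x ^ saddlePoint x y * smoothZeta (saddlePoint x y) y /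
              Real.sqrt (2 * Real.pi * saddlePhi₂ (saddlePoint x y) y))) *
          ((e₂ : ℝ) ^ (-saddlePoint x y) * (x ^ saddlePoint x y * smoothZeta (saddlePoint x y) y /
              Real.sqrt (2 * Real.pi * saddlePhi₂ (saddlePoint x y) y))) *
          ((e₃ : ℝ) ^ (-saddlePoint x y) * (x ^ saddlePoint x y * smoothZeta (saddlePoint x y) y /
              Real.sqrt (2 * Real.pi * saddlePhi₂ (saddlePoint x y) y))) *
          (C * Real.log x ^ 24 * eB *
            (P * (C * Real.log (2 * x) ^ 3 * (y : ℝ) ^ (1 / 4000 : ℝ) * Rb ^ (-(9 / 20 : ℝ)) *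
                  (2 * Real.sqrt 5 * Real.sqrt (2 * Real.pi * Φ)) +
                (164 * (1 + Real.log (2 * x)) ^ 2 * (y : ℝ) ^ 2 * (2 * x) ^ (9 / 10 : ℝ) + 1) * eB / G₀ +
                64 * Real.sqrt (2 * Real.pi * Φ) / Rb ^ 2) +
              8 * Real.sqrt (2 * Real.pi * Φ) * P / Rb ^ 3) ^ (1 / 2 : ℝ)) := by
  obtain ⟨C_m, x_m, hC_m, hMIN⟩ := parity_minor_arcs_of_minor_saddle
  obtain ⟨C_sc, x_sc, hC_sc, hSC⟩ := scale_compare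
  -- the constant
  set K₁ : ℝ := C_sc * Real.sqrt (2 * Real.pi) with hK₁
  have hK₁0 : 0 < K₁ := by positivity
  set C : ℝ := max C_m (3 * C_m * (K₁ + 1) ^ 3) with hCdef
  obtain ⟨hCm, hC3⟩ : C_m ≤ C ∧ 3 * C_m * (K₁ + 1) ^ 3 ≤ C := ⟨le_max_left _ _, le_max_right _ _⟩
  have hC0 : 0 < C := lt_of_lt_of_le hC_m hCm
  have hK3 : 3 * C_m * (K₁ * K₁ * (K₁ + 1)) ≤ C := by
    refine le_trans (mul_le_mul_of_nonneg_left ?_ (by positivity)) hC3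
    calc K₁ * K₁ * (K₁ + 1) ≤ (K₁ + 1) * (K₁ + 1) * (K₁ + 1) := by gcongr <;> linarith
      _ = (K₁ + 1) ^ 3 := by ring
  have hsqK : Real.sqrt K₁ ≤ K₁ + 1 := by
    rw [show K₁ + 1 = Real.sqrt ((K₁ + 1) ^ 2) by rw [Real.sqrt_sq (by positivity)]]
    exact Real.sqrt_le_sqrt (by nlinarith)
  have hhalf : ∀ {a : ℝ}, 0 ≤ a → (a ^ 2) ^ (1 / 2 : ℝ) = a := fun ha => by
    rw [← Real.sqrt_eq_rpow, Real.sqrt_sq ha]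
  refine ⟨C, max (max x_m x_sc) 2, hC0, ?_⟩
  intro x y e₁ e₂ e₃ eB hx hy4 hylog hα1 he₁ he₂ he₃ heB₁ heB₂ heB₃ heBx hx₁ hy8₁ hy6₁ hy200₁ hα₁ hΨ₁ hx₂ hy8₂ hy6₂
    hy200₂ hα₂ hΨ₂ hx₃ hy8₃ hy6₃ hy200₃ hα₃ hΨ₃ hy8₃' hα' hy107 N₀ hN₀ hN2 σ hσ d₁ d₂ hd₁ hd₂ R Rb hRb hRbR hRX
    c₁ c₂ c₃ hp₁ hp₂ hp₃ hc₃ P hP G₀ hG₀ hGM Φ hΦ T hT hminor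
  simp only [max_le_iff] at hx hx₁ hx₂ hx₃
  obtain ⟨⟨hxm, hxsc⟩, hx2⟩ := hx
  have hx0 : 0 < x := by linarith
  obtain ⟨he₁0, he₂0, he₃0⟩ : (0 : ℝ) < e₁ ∧ (0 : ℝ) < e₂ ∧ (0 : ℝ) < e₃ :=
    ⟨by exact_mod_cast he₁, by exact_mod_cast he₂, by exact_mod_cast he₃⟩
  obtain ⟨he₁1, he₂1, he₃1⟩ : (1 : ℝ) ≤ e₁ ∧ (1 : ℝ) ≤ e₂ ∧ (1 : ℝ) ≤ e₃ :=
    ⟨by exact_mod_cast he₁, by exact_mod_cast he₂, by exact_mod_cast he₃⟩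
  have heB1 : 1 ≤ eB := he₁1.trans heB₁
  obtain ⟨heB0, hR1, hRb0⟩ : 0 < eB ∧ 1 ≤ R ∧ 0 < Rb := ⟨by linarith, hRb.trans hRbR, by linarith⟩
  have hR0 : 0 < R := by linarith
  -- the minor-arc bound at the local saddle points
  have hM := hMIN y (x / e₁) (x / e₂) (x / e₃) hx₁.1.1 hy8₁ hy6₁ hy200₁ hα₁ hΨ₁ hx₂.1.1 hy8₂ hy6₂ hy200₂ hα₂ hΨ₂
    hx₃.1.1 hy8₃ hy6₃ hy200₃ hα₃ hΨ₃ hy8₃' N₀ hN₀ σ hσ d₁ d₂ hd₁ hd₂ R hR1 hRX c₁ c₂ c₃ hp₁ hp₂ hp₃ hc₃ T hT hminor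
  refine hM.trans ?_
  clear hM hMIN hminor hp₁ hp₂ hp₃ hd₁ hd₂ hT hΨ₁ hΨ₂ hΨ₃
  -- master-scale facts (`scale_compare`)
  obtain ⟨hx1, hy2, hα0, hφ0, -, hg⟩ := hSC x y hxsc hy4 hylog
  obtain ⟨he₁x, he₂x, he₃x⟩ : (e₁ : ℝ) ≤ x ^ (1 / 2 : ℝ) ∧ (e₂ : ℝ) ≤ x ^ (1 / 2 : ℝ) ∧ (e₃ : ℝ) ≤ x ^ (1 / 2 : ℝ) :=
    ⟨heB₁.trans heBx, heB₂.trans heBx, heB₃.trans heBx⟩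
  obtain ⟨-, -, hg₁⟩ := hg e₁ he₁
  obtain ⟨-, -, hg₂⟩ := hg e₂ he₂
  obtain ⟨hΨ₃R, -, hg₃⟩ := hg e₃ he₃
  obtain ⟨hX₁1, -, -, -, hP₁⟩ := hg₁ he₁x
  obtain ⟨hX₂1, -, -, -, hP₂⟩ := hg₂ he₂x
  obtain ⟨hX₃1, -, -, -, hP₃⟩ := hg₃ he₃x
  clear hg hg₁ hg₂ hg₃ hSC
  have hy1 : (1 : ℝ) ≤ y := by exact_mod_cast (by omega : 1 ≤ y)
  obtain ⟨hpN, hP0⟩ : 0 ≤ profileNorm c₃ ∧ 0 ≤ P := ⟨profileNorm_nonneg c₃, (profileNorm_nonneg c₃).trans hP⟩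
  have hSumP : ∑' ℓ : ℤ, ‖c₃ ℓ‖ ≤ P := (tsum_norm_le_profileNorm hc₃).trans hP
  have hSum0 : 0 ≤ ∑' ℓ : ℤ, ‖c₃ ℓ‖ := tsum_nonneg fun _ => norm_nonneg _
  -- ### names
  set α : ℝ := saddlePoint x y with hα'def
  set X₁ : ℝ := x / e₁ with hX₁'
  set X₂ : ℝ := x / e₂ with hX₂'
  set X₃ : ℝ := x / e₃ with hX₃'
  obtain ⟨hX₁0, hX₂0, hX₃0⟩ : 0 < X₁ ∧ 0 < X₂ ∧ 0 < X₃ := ⟨by linarith, by linarith, by linarith⟩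
  obtain ⟨hX₁x, hX₂x, hX₃x⟩ : X₁ ≤ x ∧ X₂ ≤ x ∧ X₃ ≤ x :=
    ⟨div_le_self hx0.le he₁1, div_le_self hx0.le he₂1, div_le_self hx0.le he₃1⟩
  set Z₀ : ℝ := Real.sqrt (2 * Real.pi * saddlePhi₂ α y) with hZ₀'
  have hZ₀0 : 0 < Z₀ := Real.sqrt_pos.2 (by positivity)
  set Z : ℝ := Real.sqrt (2 * Real.pi * Φ) with hZ'
  have hZ₀Z : Z₀ ≤ Z := Real.sqrt_le_sqrt (mul_le_mul_of_nonneg_left hΦ (by positivity))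
  obtain ⟨hZ0, hζ0⟩ : 0 < Z ∧ 0 < smoothZeta α y := ⟨lt_of_lt_of_le hZ₀0 hZ₀Z, smoothZeta_pos hα0⟩
  set M₀ : ℝ := x ^ α * smoothZeta α y / Z₀ with hM₀'
  have hM₀0 : 0 < M₀ := div_pos (mul_pos (Real.rpow_pos_of_pos hx0 _) hζ0) hZ₀0
  -- `𝓟(x) = √(2π) 𝓜`
  have h𝓟x : x ^ α * smoothZeta α y / Real.sqrt (saddlePhi₂ α y) = Real.sqrt (2 * Real.pi) * M₀ := by
    have hs0 : 0 < Real.sqrt (saddlePhi₂ α y) := Real.sqrt_pos.2 hφ0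
    have h2π : 0 < Real.sqrt (2 * Real.pi) := Real.sqrt_pos.2 (by positivity)
    have hZsplit : Z₀ = Real.sqrt (2 * Real.pi) * Real.sqrt (saddlePhi₂ α y) := by
      rw [hZ₀']; exact Real.sqrt_mul (by positivity) _
    rw [hM₀', hZsplit]
    field_simp
  set m₁ : ℝ := (e₁ : ℝ) ^ (-α) * M₀ with hm₁'
  set m₂ : ℝ := (e₂ : ℝ) ^ (-α) * M₀ with hm₂'
  set m₃ : ℝ := (e₃ : ℝ) ^ (-α) * M₀ with hm₃'
  obtain ⟨hm₁0, hm₂0, hm₃0⟩ : 0 < m₁ ∧ 0 < m₂ ∧ 0 < m₃ :=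
    ⟨mul_pos (Real.rpow_pos_of_pos he₁0 _) hM₀0, mul_pos (Real.rpow_pos_of_pos he₂0 _) hM₀0,
      mul_pos (Real.rpow_pos_of_pos he₃0 _) hM₀0⟩
  -- the local saddle data in main-term units: `𝓟(X_i) ≤ K₁ m_i`
  have h𝓟 : ∀ {e : ℕ} {X : ℝ}, X = x / e →
      (x / e) ^ saddlePoint (x / e) y * smoothZeta (saddlePoint (x / e) y) y /
          Real.sqrt (saddlePhi₂ (saddlePoint (x / e) y) y) ≤
        C_sc * (e : ℝ) ^ (-α) * (x ^ α * smoothZeta α y / Real.sqrt (saddlePhi₂ α y)) →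
      X ^ saddlePoint X y * (smoothZeta (saddlePoint X y) y / Real.sqrt (saddlePhi₂ (saddlePoint X y) y)) ≤
        K₁ * ((e : ℝ) ^ (-α) * M₀) := by
    intro e X hX h
    rw [hX, ← mul_div_assoc]
    refine h.trans (le_of_eq ?_)
    rw [h𝓟x, hK₁]; ring
  have h𝓟₁ : X₁ ^ saddlePoint X₁ y * (smoothZeta (saddlePoint X₁ y) y / Real.sqrt (saddlePhi₂ (saddlePoint X₁ y) y)) ≤
      K₁ * m₁ := h𝓟 hX₁' hP₁
  have h𝓟₂ : X₂ ^ saddlePoint X₂ y * (smoothZeta (saddlePoint X₂ y) y / Real.sqrt (saddlePhi₂ (saddlePoint X₂ y) y)) ≤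
      K₁ * m₂ := h𝓟 hX₂' hP₂
  have h𝓟₃ : X₃ ^ saddlePoint X₃ y * (smoothZeta (saddlePoint X₃ y) y / Real.sqrt (saddlePhi₂ (saddlePoint X₃ y) y)) ≤
      K₁ * m₃ := h𝓟 hX₃' hP₃
  clear hP₁ hP₂ hP₃ h𝓟
  -- Rankin at the master saddle point: `Ψ(X₃, y) ≤ m₃ Z₀`
  have hkey₃ : (e₃ : ℝ) ^ (-α) * (x ^ α * smoothZeta α y) = m₃ * Z₀ := by
    rw [hm₃', hM₀', mul_assoc, div_mul_cancel₀ _ hZ₀0.ne']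
  have hΨ₃ : ((Nat.smoothNumbersUpTo ⌊X₃⌋₊ (y + 1)).card : ℝ) ≤ m₃ * Z := by
    rw [hX₃']; rw [hkey₃] at hΨ₃R; exact hΨ₃R.trans (mul_le_mul_of_nonneg_left hZ₀Z hm₃0.le)
  clear hΨ₃R
  -- `m₃ ≥ G₀/e_B`
  have hm₃low : G₀ / eB ≤ m₃ := by
    have h1 : (e₃ : ℝ) ^ (-(1 : ℝ)) ≤ (e₃ : ℝ) ^ (-α) := Real.rpow_le_rpow_of_exponent_le he₃1 (by linarith)
    rw [Real.rpow_neg_one] at h1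
    calc G₀ / eB = eB⁻¹ * G₀ := by rw [div_eq_inv_mul]
      _ ≤ (e₃ : ℝ)⁻¹ * M₀ := mul_le_mul ((inv_le_inv₀ heB0 he₃0).2 heB₃) hGM hG₀.le (by positivity)
      _ ≤ m₃ := mul_le_mul_of_nonneg_right h1 hM₀0.le
  -- the ambient scale `x' = 2X₃` and its saddle point `α'`
  set α' : ℝ := saddlePoint (2 * X₃) y with hα''
  have hx'1 : 1 < 2 * X₃ := by linarith
  have hα'0 : 0 < α' := saddlePoint_pos hx'1 hy2
  have hα'2 : α' ≤ 2 := by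
    have hyexp : Real.exp 107 ≤ y := le_trans (Nat.le_ceil _) (by exact_mod_cast hy107)
    have hlogy : 107 ≤ Real.log y := by
      have := Real.log_le_log (Real.exp_pos _) hyexp
      rwa [Real.log_exp] at this
    have hyX : (y : ℝ) ≤ 2 * X₃ :=
      le_trans (le_trans (le_self_pow₀ hy1 (by norm_num)) hy200₃) (by linarith)
    have h := saddlePoint_le_one_add_div_log (2 * X₃) y hy107 hyX
    rw [← hα''] at h
    have h4 : 4 / Real.log y ≤ 1 := by rw [div_le_one (by linarith)]; linarith
    linarith
  -- `(2X₃)^{α'} ζ(α') ≤ 2 m₃ Z` (minimality of Rankin's bound at the saddle point of `2X₃`, competitor `α`)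
  have hTR : (2 * X₃) ^ α' * smoothZeta α' y ≤ 2 * (m₃ * Z) := by
    have h1 := rpow_mul_smoothZeta_saddlePoint_le (x := 2 * X₃) (y := y) hx'1 hy2 hα0
    rw [← hα''] at h1
    have h2 : (2 * X₃) ^ α = (2 : ℝ) ^ α * ((e₃ : ℝ) ^ (-α) * x ^ α) := by
      rw [Real.mul_rpow zero_le_two hX₃0.le, hX₃', Real.div_rpow hx0.le he₃0.le, Real.rpow_neg he₃0.le,
        div_eq_inv_mul]
    have h2α : (2 : ℝ) ^ α ≤ 2 := by
      calc (2 : ℝ) ^ α ≤ (2 : ℝ) ^ (1 : ℝ) := Real.rpow_le_rpow_of_exponent_le one_le_two hα1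
        _ = 2 := Real.rpow_one 2
    calc (2 * X₃) ^ α' * smoothZeta α' y ≤ (2 * X₃) ^ α * smoothZeta α y := h1
      _ = (2 : ℝ) ^ α * ((e₃ : ℝ) ^ (-α) * (x ^ α * smoothZeta α y)) := by rw [h2]; ring
      _ = (2 : ℝ) ^ α * (m₃ * Z₀) := by rw [hkey₃]
      _ ≤ 2 * (m₃ * Z) := mul_le_mul h2α (mul_le_mul_of_nonneg_left hZ₀Z hm₃0.le) (by positivity) zero_le_two
  have h𝓟' : (2 * X₃) ^ α' * (smoothZeta α' y / Real.sqrt (saddlePhi₂ α' y)) ≤ 2 * Real.sqrt 5 * (m₃ * Z) := by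
    have hφ' : 1 / 5 ≤ saddlePhi₂ α' y := fifth_le_saddlePhi₂ hy2 hα'0 hα'2
    have hs : Real.sqrt (1 / 5) ≤ Real.sqrt (saddlePhi₂ α' y) := Real.sqrt_le_sqrt hφ'
    have hs0 : 0 < Real.sqrt (1 / 5) := Real.sqrt_pos.2 (by norm_num)
    rw [← mul_div_assoc]
    calc (2 * X₃) ^ α' * smoothZeta α' y / Real.sqrt (saddlePhi₂ α' y) ≤ 2 * (m₃ * Z) / Real.sqrt (1 / 5) :=
          div_le_div₀ (by positivity) hTR hs0 hs
      _ = 2 * Real.sqrt 5 * (m₃ * Z) := by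
          rw [one_div, Real.sqrt_inv, div_inv_eq_mul]; ring
  clear_value α' m₁ m₂ m₃ M₀ Z Z₀ X₁ X₂ X₃ α
  -- ### the supremum of the free factor: `S ≤ m₃ s`
  have hlog2x : 0 ≤ Real.log (2 * x) := Real.log_nonneg (by linarith)
  have hζ' : 0 < smoothZeta α' y := smoothZeta_pos hα'0
  have hL₂ : Real.log (2 * X₃) ≤ Real.log (2 * x) := Real.log_le_log (by linarith) (by linarith)
  have hL₂0 : 0 ≤ Real.log (2 * X₃) := Real.log_nonneg (by linarith)
  have hS : (C_m * Real.log (2 * X₃) ^ 3 * (y : ℝ) ^ (5 / 2 * (1 - α')) * R ^ (-(1 / 2 : ℝ) + 3 / 2 * (1 - α')) *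
        ((2 * X₃) ^ α' * (smoothZeta α' y / Real.sqrt (saddlePhi₂ α' y))) +
        164 * (1 + Real.log (2 * X₃)) ^ 2 * (y : ℝ) ^ 2 * (2 * X₃) ^ (9 / 10 : ℝ) +
        32 * ((2 * X₃) ^ α' * smoothZeta α' y) / R ^ 2 + 1) * (∑' ℓ : ℤ, ‖c₃ ℓ‖) +
      8 * ((Nat.smoothNumbersUpTo ⌊X₃⌋₊ (y + 1)).card : ℝ) * profileNorm c₃ / R ^ 3 ≤
      m₃ * (P * (C * Real.log (2 * x) ^ 3 * (y : ℝ) ^ (1 / 4000 : ℝ) * Rb ^ (-(9 / 20 : ℝ)) * (2 * Real.sqrt 5 * Z) +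
          (164 * (1 + Real.log (2 * x)) ^ 2 * (y : ℝ) ^ 2 * (2 * x) ^ (9 / 10 : ℝ) + 1) * eB / G₀ + 64 * Z / Rb ^ 2) +
        8 * Z * P / Rb ^ 3) := by
    -- the four pieces of `B'(2X₃, R)`
    have hy' : (y : ℝ) ^ (5 / 2 * (1 - α')) ≤ (y : ℝ) ^ (1 / 4000 : ℝ) :=
      Real.rpow_le_rpow_of_exponent_le hy1 (by linarith)
    have hR' : R ^ (-(1 / 2 : ℝ) + 3 / 2 * (1 - α')) ≤ Rb ^ (-(9 / 20 : ℝ)) :=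
      (Real.rpow_le_rpow_of_exponent_le hR1 (by linarith)).trans
        (Real.rpow_le_rpow_of_nonpos hRb0 hRbR (by norm_num))
    have hA : C_m * Real.log (2 * X₃) ^ 3 * (y : ℝ) ^ (5 / 2 * (1 - α')) * R ^ (-(1 / 2 : ℝ) + 3 / 2 * (1 - α')) *
        ((2 * X₃) ^ α' * (smoothZeta α' y / Real.sqrt (saddlePhi₂ α' y))) ≤
        C * Real.log (2 * x) ^ 3 * (y : ℝ) ^ (1 / 4000 : ℝ) * Rb ^ (-(9 / 20 : ℝ)) * (2 * Real.sqrt 5 * (m₃ * Z)) := by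
      have h3 : Real.log (2 * X₃) ^ 3 ≤ Real.log (2 * x) ^ 3 := pow_le_pow_left₀ hL₂0 hL₂ 3
      exact mul_le_mul (mul_le_mul (mul_le_mul (mul_le_mul hCm h3 (by positivity) hC0.le) hy' (by positivity)
        (by positivity)) hR' (by positivity) (by positivity)) h𝓟' (by positivity) (by positivity)
    have hB : 164 * (1 + Real.log (2 * X₃)) ^ 2 * (y : ℝ) ^ 2 * (2 * X₃) ^ (9 / 10 : ℝ) + 1 ≤
        (164 * (1 + Real.log (2 * x)) ^ 2 * (y : ℝ) ^ 2 * (2 * x) ^ (9 / 10 : ℝ) + 1) * (m₃ * (eB / G₀)) := by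
      have h1 : 164 * (1 + Real.log (2 * X₃)) ^ 2 * (y : ℝ) ^ 2 * (2 * X₃) ^ (9 / 10 : ℝ) + 1 ≤
          164 * (1 + Real.log (2 * x)) ^ 2 * (y : ℝ) ^ 2 * (2 * x) ^ (9 / 10 : ℝ) + 1 := by
        have h91 : (2 * X₃) ^ (9 / 10 : ℝ) ≤ (2 * x) ^ (9 / 10 : ℝ) :=
          Real.rpow_le_rpow (by positivity) (by linarith) (by norm_num)
        have h92 : (1 + Real.log (2 * X₃)) ^ 2 ≤ (1 + Real.log (2 * x)) ^ 2 :=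
          pow_le_pow_left₀ (by positivity) (by linarith) 2
        have h93 : 164 * (1 + Real.log (2 * X₃)) ^ 2 * (y : ℝ) ^ 2 ≤ 164 * (1 + Real.log (2 * x)) ^ 2 * (y : ℝ) ^ 2 :=
          mul_le_mul_of_nonneg_right (mul_le_mul_of_nonneg_left h92 (by norm_num)) (by positivity)
        have h94 := mul_le_mul h93 h91 (by positivity) (by positivity)
        linarith
      have h2 : (1 : ℝ) ≤ m₃ * (eB / G₀) := by
        rw [← div_le_iff₀ (by positivity), one_div_div]; exact hm₃low
      calc _ ≤ (164 * (1 + Real.log (2 * x)) ^ 2 * (y : ℝ) ^ 2 * (2 * x) ^ (9 / 10 : ℝ) + 1) * 1 := by rw [mul_one]; exact h1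
        _ ≤ _ := mul_le_mul_of_nonneg_left h2 (by positivity)
    have hCc : 32 * ((2 * X₃) ^ α' * smoothZeta α' y) / R ^ 2 ≤ 64 * (m₃ * Z) / Rb ^ 2 := by
      calc 32 * ((2 * X₃) ^ α' * smoothZeta α' y) / R ^ 2 ≤ 32 * (2 * (m₃ * Z)) / R ^ 2 :=
            div_le_div_of_nonneg_right (mul_le_mul_of_nonneg_left hTR (by norm_num)) (by positivity)
        _ = 64 * (m₃ * Z) / R ^ 2 := by ring
        _ ≤ 64 * (m₃ * Z) / Rb ^ 2 :=
            div_le_div_of_nonneg_left (by positivity) (by positivity) (pow_le_pow_left₀ hRb0.le hRbR 2)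
    have hD : 8 * ((Nat.smoothNumbersUpTo ⌊X₃⌋₊ (y + 1)).card : ℝ) * profileNorm c₃ / R ^ 3 ≤ 8 * (m₃ * Z) * P / Rb ^ 3 := by
      calc _ ≤ 8 * (m₃ * Z) * P / R ^ 3 := div_le_div_of_nonneg_right (by gcongr) (by positivity)
        _ ≤ 8 * (m₃ * Z) * P / Rb ^ 3 :=
            div_le_div_of_nonneg_left (by positivity) (by positivity) (pow_le_pow_left₀ hRb0.le hRbR 3)
    have hsum := add_le_add (add_le_add hA hB) hCc
    have hB'0 : 0 ≤ C_m * Real.log (2 * X₃) ^ 3 * (y : ℝ) ^ (5 / 2 * (1 - α')) * R ^ (-(1 / 2 : ℝ) + 3 / 2 * (1 - α')) *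
        ((2 * X₃) ^ α' * (smoothZeta α' y / Real.sqrt (saddlePhi₂ α' y))) +
        164 * (1 + Real.log (2 * X₃)) ^ 2 * (y : ℝ) ^ 2 * (2 * X₃) ^ (9 / 10 : ℝ) +
        32 * ((2 * X₃) ^ α' * smoothZeta α' y) / R ^ 2 + 1 := by
      have := smoothZeta_pos (y := y) hα'0
      positivity
    calc _ ≤ (C * Real.log (2 * x) ^ 3 * (y : ℝ) ^ (1 / 4000 : ℝ) * Rb ^ (-(9 / 20 : ℝ)) * (2 * Real.sqrt 5 * (m₃ * Z)) +
          (164 * (1 + Real.log (2 * x)) ^ 2 * (y : ℝ) ^ 2 * (2 * x) ^ (9 / 10 : ℝ) + 1) * (m₃ * (eB / G₀)) +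
          64 * (m₃ * Z) / Rb ^ 2) * P + 8 * (m₃ * Z) * P / Rb ^ 3 := by
          refine add_le_add (mul_le_mul (by linarith [hsum]) hSumP hSum0 ?_) hD
          exact hB'0.trans (by linarith [hsum])
      _ = _ := by ring
  -- nonnegativity of `S` and of `s`
  have hS0 : 0 ≤ (C_m * Real.log (2 * X₃) ^ 3 * (y : ℝ) ^ (5 / 2 * (1 - α')) * R ^ (-(1 / 2 : ℝ) + 3 / 2 * (1 - α')) *
        ((2 * X₃) ^ α' * (smoothZeta α' y / Real.sqrt (saddlePhi₂ α' y))) +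
        164 * (1 + Real.log (2 * X₃)) ^ 2 * (y : ℝ) ^ 2 * (2 * X₃) ^ (9 / 10 : ℝ) +
        32 * ((2 * X₃) ^ α' * smoothZeta α' y) / R ^ 2 + 1) * (∑' ℓ : ℤ, ‖c₃ ℓ‖) +
      8 * ((Nat.smoothNumbersUpTo ⌊X₃⌋₊ (y + 1)).card : ℝ) * profileNorm c₃ / R ^ 3 := by
    have := smoothZeta_pos (y := y) hα'0
    positivity
  set s : ℝ := P * (C * Real.log (2 * x) ^ 3 * (y : ℝ) ^ (1 / 4000 : ℝ) * Rb ^ (-(9 / 20 : ℝ)) * (2 * Real.sqrt 5 * Z) +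
      (164 * (1 + Real.log (2 * x)) ^ 2 * (y : ℝ) ^ 2 * (2 * x) ^ (9 / 10 : ℝ) + 1) * eB / G₀ + 64 * Z / Rb ^ 2) +
    8 * Z * P / Rb ^ 3 with hsdef
  have hs0 : 0 ≤ s := by rw [hsdef]; positivity
  clear_value s
  -- ### the outer factors
  have hLx : 0 ≤ Real.log x := Real.log_nonneg hx1.le
  have hlogX : ∀ {X : ℝ}, 1 < X → X ≤ x → 0 ≤ Real.log X ∧ Real.log X ≤ Real.log x :=
    fun h1 h2 => ⟨Real.log_nonneg h1.le, Real.log_le_log (by linarith) h2⟩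
  obtain ⟨hl₁0, hl₁⟩ := hlogX hX₁1 hX₁x
  obtain ⟨hl₂0, hl₂⟩ := hlogX hX₂1 hX₂x
  obtain ⟨hl₃0, hl₃⟩ := hlogX hX₃1 hX₃x
  have hLG : (Real.log X₁ * Real.log X₂ * Real.log X₃) ^ (8 : ℕ) ≤ Real.log x ^ 24 := by
    calc (Real.log X₁ * Real.log X₂ * Real.log X₃) ^ (8 : ℕ) ≤ (Real.log x * Real.log x * Real.log x) ^ (8 : ℕ) :=
          pow_le_pow_left₀ (by positivity) (mul_le_mul (mul_le_mul hl₁ hl₂ hl₂0 hLx) hl₃ hl₃0 (by positivity)) 8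
      _ = Real.log x ^ 24 := by ring
  have hF : ∀ {e : ℕ} {X : ℝ}, X = x / e → 1 ≤ e → (e : ℝ) ≤ eB → ∀ {t : ℝ}, 0 ≤ t →
      (1 + (N₀ : ℝ) / X) ^ t ≤ (3 * eB) ^ t := by
    intro e X hX he heB t ht
    have he0 : (0 : ℝ) < e := by exact_mod_cast (show 0 < e by omega)
    refine Real.rpow_le_rpow (by rw [hX]; positivity) ?_ ht
    rw [hX, div_div_eq_mul_div, ← le_sub_iff_add_le', div_le_iff₀ hx0]
    calc (N₀ : ℝ) * e ≤ 2 * x * eB := mul_le_mul hN2 heB he0.le (by positivity)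
      _ = (3 * eB - 1) * x - (eB - 1) * x := by ring
      _ ≤ (3 * eB - 1) * x := sub_le_self _ (mul_nonneg (by linarith) hx0.le)
  have h3eB : 0 < 3 * eB := by positivity
  have hFF : (1 + (N₀ : ℝ) / X₁) ^ (2 / 5 : ℝ) * (1 + (N₀ : ℝ) / X₂) ^ (2 / 5 : ℝ) * (1 + (N₀ : ℝ) / X₃) ^ (1 / 5 : ℝ) ≤
      3 * eB := by
    calc _ ≤ (3 * eB) ^ (2 / 5 : ℝ) * (3 * eB) ^ (2 / 5 : ℝ) * (3 * eB) ^ (1 / 5 : ℝ) :=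
          mul_le_mul (mul_le_mul (hF hX₁' he₁ heB₁ (by norm_num)) (hF hX₂' he₂ heB₂ (by norm_num)) (by positivity)
            (by positivity)) (hF hX₃' he₃ heB₃ (by norm_num)) (by positivity) (by positivity)
      _ = 3 * eB := by
          rw [← Real.rpow_add h3eB, ← Real.rpow_add h3eB]; norm_num
  -- `𝓟₃^{1/2} S^{1/2} ≤ m₃ (K₁ + 1) s^{1/2}`
  have h𝓟₃0 : 0 ≤ X₃ ^ saddlePoint X₃ y * (smoothZeta (saddlePoint X₃ y) y / Real.sqrt (saddlePhi₂ (saddlePoint X₃ y) y)) := by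
    have := smoothZeta_pos (y := y) (saddlePoint_pos hX₃1 hy2); positivity
  have h3 : (X₃ ^ saddlePoint X₃ y * (smoothZeta (saddlePoint X₃ y) y / Real.sqrt (saddlePhi₂ (saddlePoint X₃ y) y))) ^
        (1 / 2 : ℝ) *
      ((C_m * Real.log (2 * X₃) ^ 3 * (y : ℝ) ^ (5 / 2 * (1 - α')) * R ^ (-(1 / 2 : ℝ) + 3 / 2 * (1 - α')) *
        ((2 * X₃) ^ α' * (smoothZeta α' y / Real.sqrt (saddlePhi₂ α' y))) +
        164 * (1 + Real.log (2 * X₃)) ^ 2 * (y : ℝ) ^ 2 * (2 * X₃) ^ (9 / 10 : ℝ) +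
        32 * ((2 * X₃) ^ α' * smoothZeta α' y) / R ^ 2 + 1) * (∑' ℓ : ℤ, ‖c₃ ℓ‖) +
      8 * ((Nat.smoothNumbersUpTo ⌊X₃⌋₊ (y + 1)).card : ℝ) * profileNorm c₃ / R ^ 3) ^ (1 / 2 : ℝ) ≤
      m₃ * (K₁ + 1) * s ^ (1 / 2 : ℝ) := by
    rw [← Real.mul_rpow h𝓟₃0 hS0]
    calc _ ≤ (m₃ ^ 2 * (K₁ * s)) ^ (1 / 2 : ℝ) := by
          refine Real.rpow_le_rpow (mul_nonneg h𝓟₃0 hS0) ?_ (by norm_num)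
          calc _ ≤ (K₁ * m₃) * (m₃ * s) := mul_le_mul h𝓟₃ hS hS0 (by positivity)
            _ = m₃ ^ 2 * (K₁ * s) := by ring
      _ = m₃ * (Real.sqrt K₁ * s ^ (1 / 2 : ℝ)) := by
          rw [Real.mul_rpow (by positivity) (by positivity), hhalf hm₃0.le, Real.mul_rpow hK₁0.le hs0,
            Real.sqrt_eq_rpow]
      _ ≤ m₃ * ((K₁ + 1) * s ^ (1 / 2 : ℝ)) :=
          mul_le_mul_of_nonneg_left (mul_le_mul_of_nonneg_right hsqK (by positivity)) hm₃0.le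
      _ = _ := by ring
  -- ### assemble
  have hζ₁ := smoothZeta_pos (y := y) (saddlePoint_pos hX₁1 hy2)
  have hζ₂ := smoothZeta_pos (y := y) (saddlePoint_pos hX₂1 hy2)
  have h12 : X₁ ^ saddlePoint X₁ y * (smoothZeta (saddlePoint X₁ y) y / Real.sqrt (saddlePhi₂ (saddlePoint X₁ y) y)) *
      (X₂ ^ saddlePoint X₂ y * (smoothZeta (saddlePoint X₂ y) y / Real.sqrt (saddlePhi₂ (saddlePoint X₂ y) y))) ≤
      (K₁ * m₁) * (K₁ * m₂) :=
    mul_le_mul h𝓟₁ h𝓟₂ (by positivity) (by positivity)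
  have h0 : C_m * (Real.log X₁ * Real.log X₂ * Real.log X₃) ^ (8 : ℕ) * (1 + (N₀ : ℝ) / X₁) ^ (2 / 5 : ℝ) *
      (1 + (N₀ : ℝ) / X₂) ^ (2 / 5 : ℝ) * (1 + (N₀ : ℝ) / X₃) ^ (1 / 5 : ℝ) ≤ C_m * Real.log x ^ 24 * (3 * eB) := by
    calc _ = C_m * (Real.log X₁ * Real.log X₂ * Real.log X₃) ^ (8 : ℕ) * ((1 + (N₀ : ℝ) / X₁) ^ (2 / 5 : ℝ) *
          (1 + (N₀ : ℝ) / X₂) ^ (2 / 5 : ℝ) * (1 + (N₀ : ℝ) / X₃) ^ (1 / 5 : ℝ)) := by ring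
      _ ≤ C_m * Real.log x ^ 24 * (3 * eB) :=
          mul_le_mul (mul_le_mul_of_nonneg_left hLG hC_m.le) hFF (by positivity) (by positivity)
  calc _ = (C_m * (Real.log X₁ * Real.log X₂ * Real.log X₃) ^ (8 : ℕ) * (1 + (N₀ : ℝ) / X₁) ^ (2 / 5 : ℝ) *
        (1 + (N₀ : ℝ) / X₂) ^ (2 / 5 : ℝ) * (1 + (N₀ : ℝ) / X₃) ^ (1 / 5 : ℝ)) *
      (X₁ ^ saddlePoint X₁ y * (smoothZeta (saddlePoint X₁ y) y / Real.sqrt (saddlePhi₂ (saddlePoint X₁ y) y)) *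
        (X₂ ^ saddlePoint X₂ y * (smoothZeta (saddlePoint X₂ y) y / Real.sqrt (saddlePhi₂ (saddlePoint X₂ y) y)))) *
      ((X₃ ^ saddlePoint X₃ y * (smoothZeta (saddlePoint X₃ y) y / Real.sqrt (saddlePhi₂ (saddlePoint X₃ y) y))) ^
          (1 / 2 : ℝ) *
        ((C_m * Real.log (2 * X₃) ^ 3 * (y : ℝ) ^ (5 / 2 * (1 - α')) * R ^ (-(1 / 2 : ℝ) + 3 / 2 * (1 - α')) *
          ((2 * X₃) ^ α' * (smoothZeta α' y / Real.sqrt (saddlePhi₂ α' y))) +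
          164 * (1 + Real.log (2 * X₃)) ^ 2 * (y : ℝ) ^ 2 * (2 * X₃) ^ (9 / 10 : ℝ) +
          32 * ((2 * X₃) ^ α' * smoothZeta α' y) / R ^ 2 + 1) * (∑' ℓ : ℤ, ‖c₃ ℓ‖) +
        8 * ((Nat.smoothNumbersUpTo ⌊X₃⌋₊ (y + 1)).card : ℝ) * profileNorm c₃ / R ^ 3) ^ (1 / 2 : ℝ)) := by ring
    _ ≤ (C_m * Real.log x ^ 24 * (3 * eB)) * ((K₁ * m₁) * (K₁ * m₂)) * (m₃ * (K₁ + 1) * s ^ (1 / 2 : ℝ)) :=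
        mul_le_mul (mul_le_mul h0 h12 (by positivity) (by positivity)) h3 (by positivity) (by positivity)
    _ = m₁ * m₂ * m₃ * ((3 * C_m * (K₁ * K₁ * (K₁ + 1))) * Real.log x ^ 24 * eB * s ^ (1 / 2 : ℝ)) := by ring
    _ ≤ m₁ * m₂ * m₃ * (C * Real.log x ^ 24 * eB * s ^ (1 / 2 : ℝ)) := by gcongr

end SmoothArcs

end Literature.NumberTheory.Sieve

end
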